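import Summits.Ventures.PercRepro.SixFourResidueThreeTwoPointsC

/-!
# The `t = 3` clause of `SixFourResidue` — plane + two points at `P = 7`, part D: the assembly (p2, gen 9)

The `g ≤ 9` piece of Theorem 21.6 at `t = 3` (§21.18.3 (β), `k = 2`, `P ≤ 7`), assembled from part C
(`SixFourResidueThreeTwoPointsC.lean`: the refined profile inequality `profIneq3c_of_profileOK`, the `dem₂` count with
the rank-`3` `5`-sets `card_dem2_le_Dem2Prof7`, the refined `dem₃` count `dem3_sum_add_coll_le`) and the share / β
bounds of `SixFourResidueThreeTwoPointsB.lean`, exactly as `J_three_nonneg_of_plane_add_two` there: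
`J_three_nonneg_of_plane_add_two' : (P₀ ∩ G).card + 2 = G.card → G.card ≤ 9 → 0 ≤ J M G 3`.
-/

namespace PercRepro.SixFour

open Finset ThmH
variable {α : Type*} [DecidableEq α] {M : Matroid α} [M.Finite] {G : Finset α}

/-! ## The `g ≤ 9` piece -/

section Final

variable (hs : Simple M) (hG : G ⊆ gr M) (hr : M.eRk (G : Set α) = 4) {P₀ : Finset α} (hP₀ : P₀ ∈ planes M)
include hs hG hr hP₀

/-- **Theorem 21.6 at `t = 3`, `g ≤ 9` (§21.18.3 (β), `k = 2`, `P ≤ 7`)**: if some plane trace has `g − 2` points,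
`0 ≤ J₃(G)`. -/
theorem J_three_nonneg_of_plane_add_two' (hcard : (P₀ ∩ G).card + 2 = G.card) (hg : G.card ≤ 9) :
    0 ≤ J M G 3 := by
  obtain ⟨a, a', ht⟩ := twoOff_of_card (M := M) hcard
  have hτ : P₀ ∩ G ⊆ gr M := Finset.inter_subset_right.trans hG
  by_cases hr3 : M.eRk ((P₀ ∩ G : Finset α) : Set α) = 3
  · have hshares := J_three_ge_shares₂ ht hG hr hP₀ hs
    set τ := P₀ ∩ G with hτdef
    have h7 : τ.card ≤ 7 := by omega
    have hsum := share3C_sum_ge hs hτ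
    have hdem2 := dem2_sum_le (M := M) (τ := τ)
    have hdem2P := card_dem2_le_Dem2Prof7 hs hτ hr3 h7
    have hdem3 := dem3_sum_add_coll_le hs hτ hr3 h7
    have hsmall := card_small_le_SmallProf hs hτ hr3 h7
    have hbeta := beta_sum_ge hτ hr3 h7
    obtain ⟨hb3, hb4, hb5, hb6⟩ := inc_bounds_of_trace hs hτ h7
    have hok := profileOK_of_trace hs hτ hr3 h7
    have hpair := pairOK_of_trace hs (τ := τ)
    have hineq := profIneq3c_of_profileOK h7 hb3 hb4 hb5 hb6 hok hpair
    unfold ProfIneq3c at hineq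
    have hT := Tcnt_eq hs hτ hr3 h7
    have hD : ((D3cnt M τ : ℕ) : ℤ) = (D3Prof τ.card (inc M τ 4) (inc M τ 5) (inc M τ 6) : ℤ) := by
      exact_mod_cast D3cnt_eq hs hτ hr3 h7
    have hLP := LPcnt_le hs hτ hr3 h7
    have hZ : 48 * ((((R3 M τ).filter (fun S => S.card + 2 ≤ τ.card)).card : ℕ) : ℤ) +
        24 * (((((R3 M τ).filter (fun S => S.card + 3 ≤ τ.card)).card : ℕ) : ℤ) - CollProf (inc M τ 5) (inc M τ 6)) +
        12 * (τ.card.choose 2 : ℤ) + 4 * ColProf (inc M τ 3) (inc M τ 4) (inc M τ 5) (inc M τ 6) ≤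
        39 * (Tcnt M τ : ℤ) + 120 * (D3cnt M τ : ℤ) - 50 * (LPcnt M τ : ℤ) := by
      rw [hT, hD]
      linarith
    have hQ : (48 : ℚ) * (((R3 M τ).filter (fun S => S.card + 2 ≤ τ.card)).card : ℚ) +
        24 * ((((R3 M τ).filter (fun S => S.card + 3 ≤ τ.card)).card : ℚ) - (CollProf (inc M τ 5) (inc M τ 6) : ℚ)) +
        12 * (τ.card.choose 2 : ℚ) + 4 * (ColProf (inc M τ 3) (inc M τ 4) (inc M τ 5) (inc M τ 6) : ℚ) ≤
        39 * (Tcnt M τ : ℚ) + 120 * (D3cnt M τ : ℚ) - 50 * (LPcnt M τ : ℚ) := by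
      exact_mod_cast hZ
    have hsplit : ∑ B ∈ R3 M τ, (share3C M B - 12 / 5 * dem2 M τ B - 6 / 5 * dem3 M τ B) =
        ∑ B ∈ R3 M τ, share3C M B - 12 / 5 * ∑ B ∈ R3 M τ, dem2 M τ B - 6 / 5 * ∑ B ∈ R3 M τ, dem3 M τ B := by
      rw [Finset.sum_sub_distrib, Finset.sum_sub_distrib, Finset.mul_sum, Finset.mul_sum]
    rw [hsplit] at hshares
    linarith
  · -- `τ` has rank `≤ 2`: every rank-`4` subset contains `a, a′`, its rest lies in `τ`, and the balance is demand-free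
    have hle2 : M.eRk ((P₀ ∩ G : Finset α) : Set α) ≤ 2 := by
      have hle3 : M.eRk ((P₀ ∩ G : Finset α) : Set α) ≤ 3 := by
        rw [← (mem_planes.1 hP₀).2.2]
        exact M.eRk_mono (Finset.coe_subset.2 Finset.inter_subset_left)
      obtain ⟨n, hn, -⟩ := eRk_eq_nat M (P₀ ∩ G)
      rw [hn] at hle3 hr3 ⊢
      have a1 : n ≤ 3 := by exact_mod_cast hle3
      have a3 : n ≠ 3 := fun h => hr3 (by rw [h]; rfl)
      exact_mod_cast (show n ≤ 2 by omega)
    apply J_three_nonneg_of_demandFree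
    intro B hB
    obtain ⟨hBG, hB4⟩ := mem_R4.1 hB
    have haB : a ∈ B := by
      by_contra haB
      have hBsub : B ⊆ insert a' (P₀ ∩ G) := by
        intro b hb
        rw [Finset.mem_insert]
        by_cases hbP : b ∈ P₀
        · exact Or.inr (Finset.mem_inter.2 ⟨hbP, hBG hb⟩)
        · rcases ht.cover b (hBG hb) hbP with rfl | rfl
          · exact absurd hb haB
          · exact Or.inl rfl
      have h1 : M.eRk ((insert a' (P₀ ∩ G) : Finset α) : Set α) ≤ M.eRk ((P₀ ∩ G : Finset α) : Set α) + 1 := by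
        rw [Finset.coe_insert]; exact M.eRk_insert_le_add_one _ _
      have : M.eRk (B : Set α) ≤ 3 := by
        calc M.eRk (B : Set α) ≤ M.eRk ((insert a' (P₀ ∩ G) : Finset α) : Set α) :=
              M.eRk_mono (Finset.coe_subset.2 hBsub)
          _ ≤ M.eRk ((P₀ ∩ G : Finset α) : Set α) + 1 := h1
          _ ≤ 2 + 1 := add_le_add_left hle2 1
          _ = 3 := by norm_num
      rw [hB4] at this
      exact absurd this (by decide)
    have ha'B : a' ∈ B := by
      by_contra ha'B
      have hBsub : B ⊆ insert a (P₀ ∩ G) := by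
        intro b hb
        rw [Finset.mem_insert]
        by_cases hbP : b ∈ P₀
        · exact Or.inr (Finset.mem_inter.2 ⟨hbP, hBG hb⟩)
        · rcases ht.cover b (hBG hb) hbP with rfl | rfl
          · exact Or.inl rfl
          · exact absurd hb ha'B
      have h1 : M.eRk ((insert a (P₀ ∩ G) : Finset α) : Set α) ≤ M.eRk ((P₀ ∩ G : Finset α) : Set α) + 1 := by
        rw [Finset.coe_insert]; exact M.eRk_insert_le_add_one _ _
      have : M.eRk (B : Set α) ≤ 3 := by
        calc M.eRk (B : Set α) ≤ M.eRk ((insert a (P₀ ∩ G) : Finset α) : Set α) :=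
              M.eRk_mono (Finset.coe_subset.2 hBsub)
          _ ≤ M.eRk ((P₀ ∩ G : Finset α) : Set α) + 1 := h1
          _ ≤ 2 + 1 := add_le_add_left hle2 1
          _ = 3 := by norm_num
      rw [hB4] at this
      exact absurd this (by decide)
    have hsub : G \ B ⊆ P₀ ∩ G := by
      intro z hz
      rw [Finset.mem_sdiff] at hz
      refine Finset.mem_inter.2 ⟨?_, hz.1⟩
      by_contra hzP
      rcases ht.cover z hz.1 hzP with rfl | rfl
      · exact hz.2 haB
      · exact hz.2 ha'B
    exact (M.eRk_mono (Finset.coe_subset.2 hsub)).trans hle2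

end Final

end PercRepro.SixFour
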